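import Mathlib
import Literature.NumberTheory.LFunctions.FeketePolynomial

/-!
# `FeketeSOS.FeketeBoundedFanin` (stmt-ValiantsHypothesis-3998), line `witt-pascal-ufa` — stub `stub_feketeExactOrder`

In a field `K` of characteristic `p` the reduction `F̄_p = Σ_{m<p} (m|p) X^m` of the Fekete polynomial
vanishes at `X = 1` to order EXACTLY `N = (p-1)/2` (Mináč–Nguyen–Tân, arXiv:2111.05256, Prop. 5.1):
`(X-1)^N ∣ F̄_p` and `(X-1)^{N+1} ∤ F̄_p`.

Proof.  By Euler's criterion `(m|p) ≡ m^{p/2}`, so `F̄_p = ϑ^{p/2} (Σ_{m<p} X^m)` with the Euler operator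
`ϑ = X·d/dX` (it multiplies the coefficient of `X^n` by `n`, `feo_coeff_iterate_XD`), and
`Σ_{m<p} X^m = (X-1)^{p-1}` in characteristic `p` (Frobenius); together `F̄_p = ϑ^{p/2} ((X-1)^{p-1})`
(`feo_map_feketePolynomial_eq`).  With `Y = X - 1` one has `ϑ(Y^k) = (Y+1)·k·Y^{k-1} = k·Y^{k-1} + k·Y^k`,
whence by induction on `j ≤ M`

  `ϑ^j (Y^M) = M(M-1)⋯(M-j+1) · Y^{M-j} + Y^{M-j+1} · R_j`             (`feo_iterate_XD_shape`).

For `M = p - 1`, `j = p/2` the exponent `M - j` is `(p-1)/2 = N`, which gives `Y^N ∣ F̄_p`; and the leading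
constant `(p-1).descFactorial (p/2)` divides `(p-1)!`, so it is prime to `p`, i.e. non-zero in `K`
(`feo_cast_descFactorial_ne_zero`), hence `Y^{N+1} ∤ F̄_p` (`feo_not_pow_succ_dvd_iterate_XD`).
The hypothesis `p ≠ 2` of the registered signature is not used.

The Euler-operator bookkeeping is adapted from Theorems/FeketeSOSFeketeNoSparseSplitFeketeModPOrder.lean
(which proves the lower bound as a `rootMultiplicity` inequality; a sibling `Theorems` module cannot be
imported here).
-/

namespace Summit.ValiantsHypothesis.ValiantsHypothesis.Theorems.FeketeBoundedFaninWPU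

open Polynomial
open Literature.NumberTheory.LFunctions

-- `Summit.ValiantsHypothesis.ValiantsHypothesis.…` is the tree's mandated single-conjunct layout (Sub = Summit).
set_option linter.dupNamespace false

section Helpers

-- adapted from Theorems/FeketeSOSFeketeNoSparseSplitFeketeModPOrder.lean (`fmo_coeff_iterate_XD`)
/-- The `j`-th iterate of the Euler operator `X·d/dX` multiplies the coefficient of `X^n` by `n^j`
(any commutative semiring). [folklore] -/
theorem feo_coeff_iterate_XD {R : Type*} [CommSemiring R] (f : R[X]) (j n : ℕ) :
    ((fun g : R[X] => X * derivative g)^[j] f).coeff n = (n : R) ^ j * f.coeff n := by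
  induction j with
  | zero => rw [Function.iterate_zero_apply, pow_zero, one_mul]
  | succ j ih =>
    rw [Function.iterate_succ_apply', pow_succ', mul_assoc, ← ih]
    show (X * derivative ((fun g : R[X] => X * derivative g)^[j] f)).coeff n = _
    cases n with
    | zero => rw [mul_coeff_zero, coeff_X_zero, zero_mul, Nat.cast_zero, zero_mul]
    | succ n => rw [coeff_X_mul, coeff_derivative, Nat.cast_succ, mul_comm]

variable {K : Type*} [Field K]

/-- **Leading term of `ϑ^j (X-1)^M` at `X = 1`**: for `j ≤ M`,
`(X·d/dX)^j ((X-1)^M) = M(M-1)⋯(M-j+1) · (X-1)^{M-j} + (X-1)^{M-j+1} · R` for some polynomial `R`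
(induction on `j`, using `X = (X - 1) + 1`). [folklore] -/
theorem feo_iterate_XD_shape (M j : ℕ) (hj : j ≤ M) :
    ∃ R : K[X], (fun g : K[X] => X * derivative g)^[j] ((X - C 1) ^ M)
      = C (M.descFactorial j : K) * (X - C 1) ^ (M - j) + (X - C 1) ^ (M - j + 1) * R := by
  induction j with
  | zero =>
    refine ⟨0, ?_⟩
    rw [Function.iterate_zero_apply, Nat.descFactorial_zero, Nat.cast_one, C_1, one_mul, mul_zero,
      add_zero, Nat.sub_zero]
  | succ j ih =>
    obtain ⟨R, hR⟩ := ih (Nat.le_of_succ_le hj)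
    obtain ⟨k, hk⟩ : ∃ k, M - j = k + 1 := ⟨M - (j + 1), by omega⟩
    refine ⟨C ((M.descFactorial j : K) * ((k : K) + 1))
      + X * (C ((k : K) + 1 + 1) * R + (X - C 1) * derivative R), ?_⟩
    rw [Function.iterate_succ_apply', hR, Nat.descFactorial_succ, show M - (j + 1) = k by omega, hk]
    simp only [derivative_add, derivative_mul, derivative_C, zero_mul, zero_add, derivative_pow_succ,
      derivative_X_sub_C, mul_one]
    simp only [Nat.cast_mul, Nat.cast_succ, map_mul, map_add, map_one, map_natCast]
    ring

/-- For a prime `p` and `k ≤ n < p`, the falling factorial `n(n-1)⋯(n-k+1)` is non-zero in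
characteristic `p` (it divides `n!`, which `p` does not divide). [folklore] -/
theorem feo_cast_descFactorial_ne_zero (p : ℕ) [Fact p.Prime] [CharP K p] {n k : ℕ} (hk : k ≤ n)
    (hn : n < p) : (n.descFactorial k : K) ≠ 0 := by
  have hp : p.Prime := Fact.out
  rw [Ne, CharP.cast_eq_zero_iff K p]
  intro h
  have h' : p ∣ n.factorial := h.trans (Dvd.intro_left _ (Nat.factorial_mul_descFactorial hk))
  have := hp.dvd_factorial.mp h'
  omega

/-- **Upper bound**: `(X-1)^{(p-1)/2 + 1}` does NOT divide `(X·d/dX)^{p/2} ((X-1)^{p-1})` in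
characteristic `p`: by `feo_iterate_XD_shape` the latter is `c · (X-1)^{(p-1)/2} + (X-1)^{(p-1)/2+1} · R`
with `c = (p-1)(p-2)⋯(p-p/2) ≢ 0 (mod p)`. [folklore] -/
theorem feo_not_pow_succ_dvd_iterate_XD (p : ℕ) [Fact p.Prime] [CharP K p] :
    ¬ (X - C 1 : K[X]) ^ ((p - 1) / 2 + 1)
        ∣ (fun g : K[X] => X * derivative g)^[p / 2] ((X - C 1) ^ (p - 1)) := by
  have hp : p.Prime := Fact.out
  have h2 := hp.two_le
  obtain ⟨R, hR⟩ := feo_iterate_XD_shape (K := K) (p - 1) (p / 2) (by omega)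
  rw [hR, show p - 1 - p / 2 = (p - 1) / 2 by omega]
  intro h
  have h' := (dvd_add_left (dvd_mul_right _ R)).mp h
  have hY : (X - C 1 : K[X]) ^ ((p - 1) / 2) ≠ 0 := pow_ne_zero _ (X_sub_C_ne_zero 1)
  rw [pow_succ', mul_dvd_mul_iff_right hY, dvd_iff_isRoot, IsRoot.def, eval_C] at h'
  exact feo_cast_descFactorial_ne_zero p (by omega) (by omega) h'

-- adapted from Theorems/FeketeSOSFeketeNoSparseSplitFeketeModPOrder.lean (`fmo_intCast_legendreSym`)
/-- **Euler's criterion in `K`**: the image of `(n|p)` under `ℤ → K` is `n ^ (p/2)` in a field of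
characteristic `p` (Mathlib's `legendreSym.eq_pow` transported along `ZMod p →+* K`). [folklore] -/
theorem feo_castRingHom_legendreSym (p : ℕ) [Fact p.Prime] [CharP K p] (n : ℕ) :
    Int.castRingHom K (legendreSym p n) = (n : K) ^ (p / 2) := by
  rw [eq_intCast, ← map_intCast (ZMod.castHom (dvd_refl p) K) (legendreSym p n), legendreSym.eq_pow,
    map_pow, Int.cast_natCast, map_natCast]

-- adapted from Theorems/FeketeSOSFeketeNoSparseSplitFeketeModPOrder.lean
-- (`fmo_geom_sum_eq` + `fmo_map_feketePolynomial_eq`, merged)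
/-- **`F̄_p = (X·d/dX)^{p/2} ((X-1)^{p-1})`** in characteristic `p`: coefficientwise this is Euler's
criterion, once `(X-1)^{p-1}` is identified with `Σ_{m<p} X^m` (Frobenius `(X-1)^p = X^p - 1` and the
telescoping `(Σ_{m<p} X^m)(X-1) = X^p - 1`). [folklore] -/
theorem feo_map_feketePolynomial_eq (p : ℕ) [Fact p.Prime] [CharP K p] :
    (feketePolynomial p).map (Int.castRingHom K)
      = (fun g : K[X] => X * derivative g)^[p / 2] ((X - C 1 : K[X]) ^ (p - 1)) := by
  have hp : p.Prime := Fact.out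
  have hgeom : (X - C 1 : K[X]) ^ (p - 1) = ∑ m ∈ Finset.range p, (X : K[X]) ^ m := by
    have hfrob : (X - C (1 : K)) ^ p = X ^ p - 1 := by
      rw [sub_pow_char, ← C_pow, one_pow, C_1]
    apply mul_right_cancel₀ (X_sub_C_ne_zero (1 : K))
    rw [← pow_succ, Nat.sub_add_cancel hp.one_le, hfrob, C_1, geom_sum_mul]
  ext n
  rw [hgeom, feo_coeff_iterate_XD, coeff_map, coeff_feketePolynomial, finsetSum_coeff]
  simp only [coeff_X_pow, Finset.sum_ite_eq, Finset.mem_range]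
  split_ifs
  · rw [feo_castRingHom_legendreSym, mul_one]
  · rw [map_zero, mul_zero]

end Helpers

/-- **The order of `F̄_p` at `1` is EXACTLY `(p-1)/2`** in every field of characteristic `p`:
`(X-1)^{(p-1)/2} ∣ F̄_p` and `(X-1)^{(p-1)/2+1} ∤ F̄_p` (Mináč–Nguyen–Tân, arXiv:2111.05256, Prop. 5.1;
the hypothesis `p ≠ 2` is not needed). [folklore] -/
theorem stub_feketeExactOrder :
    ∀ (K : Type) [Field K] (p : ℕ) [Fact p.Prime] [CharP K p], p ≠ 2 →
      (X - C 1 : K[X]) ^ ((p - 1) / 2) ∣ (feketePolynomial p).map (Int.castRingHom K) ∧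
      ¬ (X - C 1 : K[X]) ^ ((p - 1) / 2 + 1) ∣ (feketePolynomial p).map (Int.castRingHom K) := by
  intro K _ p _ _ _
  have h2 := (Fact.out : p.Prime).two_le
  rw [feo_map_feketePolynomial_eq p]
  refine ⟨?_, feo_not_pow_succ_dvd_iterate_XD p⟩
  obtain ⟨R, hR⟩ := feo_iterate_XD_shape (K := K) (p - 1) (p / 2) (by omega)
  rw [hR, show p - 1 - p / 2 = (p - 1) / 2 by omega]
  exact dvd_add (dvd_mul_left _ _) (dvd_mul_of_dvd_left (pow_dvd_pow _ (Nat.le_succ _)) _)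

end Summit.ValiantsHypothesis.ValiantsHypothesis.Theorems.FeketeBoundedFaninWPU
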